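import Summits.ResolutionOfSingularities.ResolutionOfSingularities.Theorems.SharpStrataSepExcModelsDefs
import Summits.ResolutionOfSingularities.ResolutionOfSingularities.Theorems.SharpStrataSepExcModelsDvrPairValuation
import Summits.ResolutionOfSingularities.ResolutionOfSingularities.Theorems.SharpStrataSepExcModelsRatAbhyankarPoint
import Literature.AlgebraicGeometry.Motives.SubschemeCyclesRatStalkProofs
import Literature.AlgebraicGeometry.Motives.SubschemeCyclesDimProofs
import Literature.AlgebraicGeometry.Motives.CyclesDimensionFunctionField
import Literature.AlgebraicGeometry.Motives.CyclesDivisorDimensionProofs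
import Mathlib.AlgebraicGeometry.FunctionField
import HarnessLib

/-!
# A codimension-two point with a DVR flag is separably exceptional

Line `birth` of crux `SharpStrata.SepExcModels` (stmt-ResolutionOfSingularities-16828,
`Cruxes/SepExcModels/Lines/birth.lean`), lead c1, tool stub (T3, SCHEME form)
`stub_sepExcAt_of_dvrFlag`, PROVED.

Setting: `k` a perfect field, `Y` an integral scheme locally of finite type over `k`, a
generisation `w ⤳ ζ` in `Y` with `𝒪_{Y,w}` a discrete valuation ring (`w` the generic point of a
prime divisor through `ζ` along which `Y` is regular) such that the closure of `w` is regular at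
`ζ` in codimension one — `𝒪_{Y,ζ} ⧸ 𝔭_w` a discrete valuation ring, where
`𝔭_w = (𝒪_{Y,ζ} → 𝒪_{Y,w})⁻¹ 𝔪_w` — and `dim 𝒪_{Y,ζ} ≤ 2`. Conclusion: `Y` is separably
exceptional at `ζ` (`SepExcAt Y ζ`, `Theorems/SharpStrataSepExcModelsDefs.lean`; Benito–Piltant–
Reguera 2022, Question 6.6). On a normal threefold: a singular curve is blunt at its generic point
as soon as one surface through it is regular along it.

## Proof (assembly of the two landed tools of the line)

* `DvrPairValuation.stub_ratAbhyankarPlace_of_dvrPair` (T3, ring form,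
  `Theorems/SharpStrataSepExcModelsDvrPairValuation.lean`): a DVR flag `W = R_P`, `R ⧸ P` of a
  local domain `R` with fraction field `K` over `k` carries a valuation ring `O ⊇ R` of `K`
  dominating `R`, Abhyankar over `k` and residually rational over `R`, provided `R` contains lifts
  `y₁, …, y_τ` of a family of residues algebraically independent over `k` with
  `tr.deg_k K ≤ τ + 2` (the composite of the two discrete valuations; Knaf–Kuhlmann 2005,
  Thm. 2.1);
* `RatAbhyankarPoint.stub_sepExcAt_of_ratAbhyankarPlace` (T2, scheme form,
  `Theorems/SharpStrataSepExcModelsRatAbhyankarPoint.lean`): such a valuation centred at `ζ` makes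
  `ζ` separably exceptional (Knaf–Kuhlmann 2005, Thm. 1.1).

The plumbing, with `R = 𝒪_{Y,ζ}`, `K = K(Y)` (Mathlib `stalkFunctionFieldAlgebra`,
`IsFractionRing (Y.presheaf.stalk ζ) Y.functionField`), `k → Γ(Spec k) → Γ(Y, ⊤) → R → K`
(`TopCat.Presheaf.germ_stalkSpecializes`), `W = 𝒪_{Y,w}`, `P = 𝔭_w`:

* `𝒪_{Y,w}` is the localisation of `𝒪_{Y,ζ}` at `𝔭_w` along `stalkSpecializes`
  (`Literature.AlgebraicGeometry.Motives.isLocalizationAtPrime_stalkSpecializes`, Stacks 01J7);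
* `height_eq_toENat_trdeg_residueField_stalk`: `dim cl{ζ} = tr.deg_k κ(ζ)`
  (`Literature.AlgebraicGeometry.Motives.Scheme.height_eq_toENat_trdeg_residueField`,
  Görtz–Wedhorn I, Thm. 5.22 (1)), for `κ(ζ) = 𝒪_{Y,ζ} ⧸ 𝔪_ζ` with the quotient `k`-structure;
* `trdeg_residueField_lt_aleph0`, `trdeg_functionField_le`: `tr.deg_k κ(ζ)` is finite and
  `tr.deg_k K(Y) ≤ tr.deg_k κ(ζ) + d` whenever `dim 𝒪_{Y,ζ} ≤ d`, from
  `dim Y = tr.deg_k K(Y)` (`Literature.AlgebraicGeometry.Motives.height_top_eq_trdeg`,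
  Görtz–Wedhorn I, Thm. 5.22 (3)), `dim cl{ζ} + dim 𝒪_{Y,ζ} = dim Y`
  (`Literature.AlgebraicGeometry.Motives.Scheme.height_add_coheight_eq_height_top`, Stacks 0A21)
  and `dim 𝒪_{Y,ζ} = coheight ζ` (Mathlib `ringKrullDim_stalk_eq_coheight`);
* `stub_sepExcAt_of_dvrFlag`: lift a (finite) transcendence basis of `κ(ζ) | k` to
  `y : Fin τ → 𝒪_{Y,ζ}` (`exists_isTranscendenceBasis`, `IsLocalRing.residue_surjective`), apply
  T3 with `tr.deg_k K(Y) ≤ τ + 2`, then T2.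

## Sources

* H. Knaf, F.-V. Kuhlmann, *Abhyankar places admit local uniformization in any characteristic*,
  Ann. Sci. ÉNS 38 (2005) 833–846, Thm. 1.1, Thm. 2.1. [KnafKuhlmann2005]
* A. Benito, O. Piltant, A. J. Reguera, *Small irreducible components of arc spaces in positive
  characteristic*, J. Pure Appl. Algebra 226 (2022), Question 6.6. [BenitoPiltantReguera2022]
* U. Görtz, T. Wedhorn, *Algebraic Geometry I*, 2nd ed. (2020), Thm. 5.22. [GortzWedhorn2020]
-/

noncomputable section

-- single-problem summit: the doubled namespace component `ResolutionOfSingularities` is forced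
set_option linter.dupNamespace false

open CategoryTheory AlgebraicGeometry TopologicalSpace
open Literature.AlgebraicGeometry.Resolution IsLocalRing
open Summit.ResolutionOfSingularities.ResolutionOfSingularities.Theorems.SepExcModels

namespace Summit.ResolutionOfSingularities.ResolutionOfSingularities.Theorems.SepExcModels.DvrFlagPoint

/-! ## Dimension count: `tr.deg_k K(Y) ≤ tr.deg_k κ(ζ) + dim 𝒪_{Y,ζ}` -/

section Dimension

variable {k : Type} [Field k] {Y : Scheme.{0}} [IsIntegral Y] (f : Y ⟶ Spec (.of k))
  [LocallyOfFiniteType f]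

omit [IsIntegral Y] in
/-- **`dim cl{ζ} = tr.deg_k κ(ζ)`** for a point `ζ` of a scheme locally of finite type over a
field `k` (Görtz–Wedhorn I, Thm. 5.22 (1)), with `κ(ζ) = 𝒪_{Y,ζ} ⧸ 𝔪_ζ` a `k`-algebra through
`k → Γ(Spec k) → Γ(Y, ⊤) → 𝒪_{Y,ζ} → κ(ζ)`: the instance of
`Literature.AlgebraicGeometry.Motives.Scheme.height_eq_toENat_trdeg_residueField` whose
compatibility hypothesis (`Spec κ(ζ) → Y → Spec k` is `Spec` of the structure map) is
`Literature.AlgebraicGeometry.Motives.Scheme.SpecMap_ΓSpecIso_inv_appTop_Γevaluation`.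
[cite: GortzWedhorn2020, Thm. 5.22 (1)] -/
theorem height_eq_toENat_trdeg_residueField_stalk (ζ : Y) :
    letI := ((Y.presheaf.germ ⊤ ζ trivial).hom.comp
      (f.appTop.hom.comp (Scheme.ΓSpecIso (.of k)).inv.hom)).toAlgebra
    Order.height ζ = Cardinal.toENat (Algebra.trdeg k (ResidueField (Y.presheaf.stalk ζ))) := by
  letI algR := ((Y.presheaf.germ ⊤ ζ trivial).hom.comp
      (f.appTop.hom.comp (Scheme.ΓSpecIso (.of k)).inv.hom)).toAlgebra
  letI algκ : Algebra k (Y.residueField ζ) := ResidueField.algebra (Y.presheaf.stalk ζ)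
  have halg : Spec.map (CommRingCat.ofHom (algebraMap k (Y.residueField ζ))) =
      Y.fromSpecResidueField ζ ≫ f := by
    rw [← Literature.AlgebraicGeometry.Motives.Scheme.SpecMap_ΓSpecIso_inv_appTop_Γevaluation f ζ]
    rfl
  exact Literature.AlgebraicGeometry.Motives.Scheme.height_eq_toENat_trdeg_residueField f ζ halg

/-- **`tr.deg_k κ(ζ)` is finite** for a point `ζ` of an integral scheme `Y` locally of finite type
over a field `k` (`κ(ζ)` with the `k`-structure through `Γ(Y, ⊤) → 𝒪_{Y,ζ}`): it is
`dim cl{ζ} ≤ dim Y = tr.deg_k K(Y) < ℵ₀` (`height_eq_toENat_trdeg_residueField_stalk`,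
`Literature.AlgebraicGeometry.Motives.Scheme.height_add_coheight_eq_height_top`,
`Literature.AlgebraicGeometry.Motives.height_top_eq_trdeg`).
[cite: GortzWedhorn2020, Thm. 5.22] -/
theorem trdeg_residueField_lt_aleph0 (ζ : Y) :
    letI := ((Y.presheaf.germ ⊤ ζ trivial).hom.comp
      (f.appTop.hom.comp (Scheme.ΓSpecIso (.of k)).inv.hom)).toAlgebra
    Algebra.trdeg k (ResidueField (Y.presheaf.stalk ζ)) < Cardinal.aleph0 := by
  letI algK := ((Y.presheaf.germ ⊤ (genericPoint Y) trivial).hom.comp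
      (f.appTop.hom.comp (Scheme.ΓSpecIso (.of k)).inv.hom)).toAlgebra
  letI algR := ((Y.presheaf.germ ⊤ ζ trivial).hom.comp
      (f.appTop.hom.comp (Scheme.ΓSpecIso (.of k)).inv.hom)).toAlgebra
  have htop : Order.height (⊤ : Y) = (Cardinal.toNat (Algebra.trdeg k Y.functionField) : ℕ∞) := by
    exact_mod_cast Literature.AlgebraicGeometry.Motives.height_top_eq_trdeg f
  rw [← Cardinal.toENat_lt_top, ← height_eq_toENat_trdeg_residueField_stalk f ζ]
  refine lt_of_le_of_lt (le_self_add.trans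
    (Literature.AlgebraicGeometry.Motives.Scheme.height_add_coheight_eq_height_top f ζ).le) ?_
  rw [htop]
  exact ENat.coe_lt_top _

/-- **`tr.deg_k K(Y) ≤ tr.deg_k κ(ζ) + d` when `dim 𝒪_{Y,ζ} ≤ d`**, for a point `ζ` of an
integral scheme `Y` locally of finite type over a field `k` (the `k`-structures on `K(Y)` and
`κ(ζ)` through `Γ(Y, ⊤)`; `tr.deg_k κ(ζ)` is finite, `trdeg_residueField_lt_aleph0`, and enters
through `Cardinal.toNat`): `tr.deg_k K(Y) = dim Y`
(`Literature.AlgebraicGeometry.Motives.height_top_eq_trdeg`, Görtz–Wedhorn I, Thm. 5.22 (3))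
`= dim cl{ζ} + coheight ζ`
(`Literature.AlgebraicGeometry.Motives.Scheme.height_add_coheight_eq_height_top`, Stacks 0A21),
`dim cl{ζ} = tr.deg_k κ(ζ)` (`height_eq_toENat_trdeg_residueField_stalk`) and
`coheight ζ = dim 𝒪_{Y,ζ}` (Mathlib `ringKrullDim_stalk_eq_coheight`).
[cite: GortzWedhorn2020, Thm. 5.22] -/
theorem trdeg_functionField_le (ζ : Y) {d : ℕ} (hdim : ringKrullDim (Y.presheaf.stalk ζ) ≤ d) :
    letI := ((Y.presheaf.germ ⊤ (genericPoint Y) trivial).hom.comp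
      (f.appTop.hom.comp (Scheme.ΓSpecIso (.of k)).inv.hom)).toAlgebra
    letI := ((Y.presheaf.germ ⊤ ζ trivial).hom.comp
      (f.appTop.hom.comp (Scheme.ΓSpecIso (.of k)).inv.hom)).toAlgebra
    Algebra.trdeg k Y.functionField ≤
      (Cardinal.toNat (Algebra.trdeg k (ResidueField (Y.presheaf.stalk ζ))) + d : ℕ) := by
  letI algK := ((Y.presheaf.germ ⊤ (genericPoint Y) trivial).hom.comp
      (f.appTop.hom.comp (Scheme.ΓSpecIso (.of k)).inv.hom)).toAlgebra
  letI algR := ((Y.presheaf.germ ⊤ ζ trivial).hom.comp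
      (f.appTop.hom.comp (Scheme.ΓSpecIso (.of k)).inv.hom)).toAlgebra
  -- `dim Y = tr.deg_k K(Y)`, a natural number `nK`
  have hK := Cardinal.cast_toNat_of_lt_aleph0
    (Literature.AlgebraicGeometry.Motives.trdeg_functionField_lt_aleph0 f)
  set nK := Cardinal.toNat (Algebra.trdeg k Y.functionField)
  have htop : Order.height (⊤ : Y) = (nK : ℕ∞) := by
    exact_mod_cast Literature.AlgebraicGeometry.Motives.height_top_eq_trdeg f
  -- `coheight ζ = dim 𝒪_{Y,ζ} ≤ d`
  have hcoh : Order.coheight ζ ≤ (d : ℕ∞) := by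
    have h : (Order.coheight ζ : WithBot ℕ∞) ≤ d := by
      rw [← ringKrullDim_stalk_eq_coheight ζ]
      exact hdim
    exact_mod_cast h
  -- `height ζ = tr.deg_k κ(ζ)`, a natural number `τ`
  have hκ := Cardinal.cast_toNat_of_lt_aleph0 (trdeg_residueField_lt_aleph0 f ζ)
  set τ := Cardinal.toNat (Algebra.trdeg k (ResidueField (Y.presheaf.stalk ζ)))
  have hζ : Order.height ζ = (τ : ℕ∞) := by
    rw [height_eq_toENat_trdeg_residueField_stalk f ζ, ← hκ, Cardinal.toENat_nat]
  -- `nK = height ζ + coheight ζ ≤ τ + d`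
  have h : (nK : ℕ∞) ≤ τ + d := by
    rw [← htop, ← Literature.AlgebraicGeometry.Motives.Scheme.height_add_coheight_eq_height_top f ζ,
      hζ]
    exact add_le_add le_rfl hcoh
  have h' : nK ≤ τ + d := by exact_mod_cast h
  rw [← hK]
  exact_mod_cast h'

end Dimension

/-! ## The registered stub -/

/-- **STUB (T3, scheme form) of line `birth` of crux `SepExcModels`, PROVED: a point of
codimension two with a DVR flag is separably exceptional.** For an integral `Y` locally of finite
type over a perfect field `k`, a generisation `w ⤳ ζ` with `𝒪_{Y,w}` a DVR such that `cl{w}` is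
regular at `ζ` in codimension one (`𝒪_{Y,ζ} ⧸ 𝔭_w` a DVR, `𝔭_w = (𝒪_{Y,ζ} → 𝒪_{Y,w})⁻¹ 𝔪_w`)
and `dim 𝒪_{Y,ζ} ≤ 2`: `SepExcAt Y ζ`. Assembly of
`DvrPairValuation.stub_ratAbhyankarPlace_of_dvrPair` — `𝒪_{Y,w}` is the localisation of
`𝒪_{Y,ζ}` at `𝔭_w` (`Literature.AlgebraicGeometry.Motives.isLocalizationAtPrime_stalkSpecializes`),
`y : Fin τ → 𝒪_{Y,ζ}` lifts a transcendence basis of `κ(ζ) | k` (`exists_isTranscendenceBasis`,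
`IsLocalRing.residue_surjective`), `tr.deg_k K(Y) ≤ τ + 2` (`trdeg_functionField_le`) — which
yields a residually rational Abhyankar valuation of `K(Y) | k` centred at `ζ` (the composite of the
two discrete valuations, Knaf–Kuhlmann 2005 Thm. 2.1), and of
`RatAbhyankarPoint.stub_sepExcAt_of_ratAbhyankarPlace` (Knaf–Kuhlmann 2005, Thm. 1.1), which turns
it into the separable regular local model of `SepExcAt`.
[cite: KnafKuhlmann2005, Thm. 1.1, Thm. 2.1] -/
theorem stub_sepExcAt_of_dvrFlag (k : Type) [Field k] [PerfectField k]
    (Y : Scheme.{0}) [IsIntegral Y] (f : Y ⟶ Spec (.of k)) [LocallyOfFiniteType f] (ζ w : Y)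
    (hw : w ⤳ ζ) (hW : IsDiscreteValuationRing (Y.presheaf.stalk w))
    (hD : IsDiscreteValuationRing (Y.presheaf.stalk ζ ⧸
      (IsLocalRing.maximalIdeal (Y.presheaf.stalk w)).comap (Y.presheaf.stalkSpecializes hw).hom))
    (hdim : ringKrullDim (Y.presheaf.stalk ζ) ≤ 2) :
    SepExcAt Y ζ := by
  -- the `k`-algebra structures on `K = K(Y)` and on `R = 𝒪_{Y,ζ}` (a tower along
  -- `R → K = stalkSpecializes`, Mathlib `stalkFunctionFieldAlgebra`)
  letI algK : Algebra k Y.functionField := ((Y.presheaf.germ ⊤ (genericPoint Y) trivial).hom.comp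
      (f.appTop.hom.comp (Scheme.ΓSpecIso (.of k)).inv.hom)).toAlgebra
  letI algR : Algebra k (Y.presheaf.stalk ζ) := ((Y.presheaf.germ ⊤ ζ trivial).hom.comp
      (f.appTop.hom.comp (Scheme.ΓSpecIso (.of k)).inv.hom)).toAlgebra
  haveI : IsScalarTower k (Y.presheaf.stalk ζ) Y.functionField := by
    refine IsScalarTower.of_algebraMap_eq fun c => ?_
    change _ = (Y.presheaf.stalkSpecializes _).hom ((Y.presheaf.germ ⊤ ζ trivial).hom _)
    rw [← CategoryTheory.comp_apply, TopCat.Presheaf.germ_stalkSpecializes]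
    rfl
  -- `W = 𝒪_{Y,w}` is the localisation of `R` at `P = 𝔭_w` (Stacks 01J7), a DVR
  letI algW : Algebra (Y.presheaf.stalk ζ) (Y.presheaf.stalk w) :=
    (Y.presheaf.stalkSpecializes hw).hom.toAlgebra
  haveI : IsLocalization.AtPrime (Y.presheaf.stalk w)
      ((maximalIdeal (Y.presheaf.stalk w)).comap (Y.presheaf.stalkSpecializes hw).hom) :=
    Literature.AlgebraicGeometry.Motives.isLocalizationAtPrime_stalkSpecializes hw
  haveI := hW
  -- a (finite) transcendence basis of `κ(ζ) | k`, indexed by `Fin τ` and lifted to `R`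
  have hfin := trdeg_residueField_lt_aleph0 f ζ
  haveI : FaithfulSMul k (ResidueField (Y.presheaf.stalk ζ)) :=
    (faithfulSMul_iff_algebraMap_injective k _).mpr (algebraMap k _).injective
  obtain ⟨s, hs⟩ := exists_isTranscendenceBasis k (ResidueField (Y.presheaf.stalk ζ))
  have hcard : Cardinal.mk (Fin (Cardinal.toNat
      (Algebra.trdeg k (ResidueField (Y.presheaf.stalk ζ))))) = Cardinal.mk s := by
    rw [Cardinal.mk_fin, hs.cardinalMk_eq_trdeg, Cardinal.cast_toNat_of_lt_aleph0 hfin]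
  obtain ⟨e⟩ := Cardinal.eq.mp hcard
  choose y hy using
    fun j => IsLocalRing.residue_surjective (R := Y.presheaf.stalk ζ) ((e j : s) : _)
  have hy' : AlgebraicIndependent k fun j => residue (Y.presheaf.stalk ζ) (y j) := by
    rw [show (fun j => residue (Y.presheaf.stalk ζ) (y j)) = Subtype.val ∘ e from funext hy]
    exact hs.1.comp _ e.injective
  -- the composite valuation (T3, ring form; `tr.deg_k K(Y) ≤ τ + 2` by `trdeg_functionField_le`)
  -- and the valuative criterion (T2, scheme form)
  obtain ⟨O, hRO, hdom, hAbh, hrat⟩ :=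
    DvrPairValuation.stub_ratAbhyankarPlace_of_dvrPair (k := k) (K := Y.functionField)
      (W := Y.presheaf.stalk w)
      ((maximalIdeal (Y.presheaf.stalk w)).comap (Y.presheaf.stalkSpecializes hw).hom) hD y hy'
      (trdeg_functionField_le f ζ hdim)
  exact RatAbhyankarPoint.stub_sepExcAt_of_ratAbhyankarPlace k Y f ζ O hRO hdom hAbh hrat

end Summit.ResolutionOfSingularities.ResolutionOfSingularities.Theorems.SepExcModels.DvrFlagPoint

end
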